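/-
Copyright (c) 2026 the pub-hodgecm-mathlib formalisation cell (harness21).  Prover seat hodgecm-mathlib-K2E3-p20 (g0),
Track B «K2-LIT» ∕ h413, line `K2_E3_EllipticInputs`, unit U5Kazhdan, socket #20P (DISC-PL) — MEMO-20P-road §3 S2, second half:
Harish-Chandra's Theorem 1 (b) (orthogonality of coefficients of inequivalent irreducibles) for SQUARE-INTEGRABLE representations.  2026-09-03.
-/
import Summits.HodgeConjecture.HodgeConjecture.Theorems.K2E3SchurOrthogonalitySquareIntegrable   -- ★ p855390: Thm 1 (a) for `L²` coefficients (brings ★ Schur-sc, ★ AdmissibleInvariantFormSchur)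
import HarnessLib

/-!
# K2_E3 road (h413 = stmt-HodgeConjecture-24833), socket #20P «DISC-PL» — S2 «formalDegreeL2», part (b): ORTHOGONALITY OF THE COEFFICIENTS OF
# INEQUIVALENT IRREDUCIBLES FOR SQUARE-INTEGRABLE REPRESENTATIONS (Harish-Chandra 1970, Part I §1 Theorem 1 (b))

Cell `pub/hodgecm-mathlib` (D-0151), Track B, line `Summits/HodgeConjecture/HodgeConjecture/Cruxes/H413/Lines/K2_E3_EllipticInputs.lean`, unit U5Kazhdan,
socket #20P `sig_K2E3DiscretePlancherelCuspidal` (annex `…Sigs_U5bWildPlancherel.lean` :144; MEMO-20P-road 6ab33264ff32dae1 §3 S2).  Helper file (`--supports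
stmt-HodgeConjecture-24833 --as helper`, no socket closed); THEOREMS ONLY (no `def`, no instance, no notation, no named fact, no `sorry`); ★-only imports.

THE POINT.  [HarishChandra1970, Part I §1 Theorem 1 (b)]: «if `π` is not equivalent to `π′`, then `∫_{G∕Z} conj (φ₁, π(x)ψ₁) (φ₂, π′(x)ψ₂) dx* = 0`» for
square-integrable `π, π′`.  ★ `IsSupercuspidal.integral_conj_matrixCoeff_mul_matrixCoeff_eq_zero` proves it for SUPERCUSPIDAL `ρ` (and any smooth `σ`),
using supercuspidality at ONE point — the integrability of `x ↦ conj (B (ρ x b) a) · φ (σ x⁻¹ w)` (compact support).  Here that integrability is taken from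
square-integrability of BOTH factors: the coefficients `x ↦ B w (ρ x v)` of `ρ` are in `L²(G, ν)` (`hL2`) and the coefficients `x ↦ φ (σ x w′)` of the smooth
functional `φ` on `σ` are in `L²(G, ν)` (`hφ`; inversion invariance of `ν` moves `x⁻¹` across) — Hölder `2 + 2`.  Everything after (the invariant pairing,
Riesz ★ `exists_sesqForm_apply_eq_of_mem_contragredient`, the intertwiner `A : σ → ρ`, `A = 0`) is the ★ argument verbatim.
* **`integral_conj_matrixCoeff_mul_matrixCoeff_eq_zero_of_memLp`** — `∫ conj (B b (ρ x a)) · φ (σ x w) dν = 0` whenever `σ` admits no non-zero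
  intertwiner to `ρ`; **`…_of_isEmpty_of_memLp`** — the case `σ` irreducible, `IsEmpty (σ.Equiv ρ)`.
With ★ p855390 (Theorem 1 (a)) this completes Harish-Chandra's Theorem 1 for representations with `L²` coefficients on a group with compact centre — the
Schur-orthogonality layer of socket #20P's in-house road (MEMO §3 S2); S1 (finiteness of `E₂(G)^K`) and S3 (the inversion) remain.
HONEST LABEL: count-neutral; HC_CM is proved only modulo the 7 printed citations (2 remaining named inputs: hLiu418 = stmt-HodgeConjecture-24832, h413 =
stmt-HodgeConjecture-24833) until rung 0 closes; this `--supports` helper retires nothing by itself.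

## References
* [HarishChandra1970] Harish-Chandra (notes by G. van Dijk), *Harmonic Analysis on Reductive p-adic Groups*, LNM 162 (1970), Part I §1 Theorem 1 (b), p. 4.
* [Rogawski1990] J. D. Rogawski, *Automorphic Representations of Unitary Groups in Three Variables*, Ann. of Math. Stud. 123 (1990), §12.6 Prop. 12.6.1 p. 188.
-/

set_option autoImplicit false
-- the mandated namespace has the single-problem summit's repeated segment (`HodgeConjecture.HodgeConjecture`)
set_option linter.dupNamespace false

noncomputable section

open MeasureTheory Filter Topology
open scoped ComplexConjugate
open Literature.NumberTheory.Automorphic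

namespace Summit.HodgeConjecture.HodgeConjecture.Cruxes.H413.K2E3SchurOrthogonalityBSquareIntegrable

section Generic

variable {G V : Type*} [Group G] [TopologicalSpace G] [NonarchimedeanGroup G]
  [LocallyCompactSpace G] [T2Space G] [MeasurableSpace G] [BorelSpace G]
  [AddCommGroup V] [Module ℂ V] {ρ : Representation ℂ G V} {B : V →ₗ⋆[ℂ] V →ₗ[ℂ] ℂ}

/-- **HARISH-CHANDRA'S THEOREM 1 (b) FOR SQUARE-INTEGRABLE REPRESENTATIONS.**  Let `ρ` be irreducible admissible with `L²(G, ν)` coefficients (`hL2`), `B` a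
`G`-invariant positive-definite Hermitian form, `ν` an inversion-invariant Haar measure, and `σ` ANY smooth representation on `W` admitting no non-zero
intertwiner `σ → ρ`; let `φ ∈ Module.Dual ℂ W` have `L²(G, ν)` coefficients `x ↦ φ (σ x w′)` (`hφ`).  Then for all `w ∈ W`, `a b ∈ V`:
`∫ conj (B b (ρ x a)) · φ (σ x w) dν(x) = 0`.  Proof = ★ `IsSupercuspidal.integral_conj_matrixCoeff_mul_matrixCoeff_eq_zero` with the integrability of
`x ↦ conj (B (ρ x b) a) · φ (σ x⁻¹ w′)` from Hölder `2 + 2` (`conj (B (ρ x b) a) = B a (ρ x b) ∈ L²`; `x ↦ φ (σ x⁻¹ w′) ∈ L²` by inversion invariance).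
[cite: HarishChandra1970, Part I §1 Theorem 1 (b)] -/
theorem integral_conj_matrixCoeff_mul_matrixCoeff_eq_zero_of_memLp [ρ.IsIrreducible]
    (hadm : ρ.IsAdmissible) (hBsymm : B.IsSymm)
    (hBpos : ∀ v : V, v ≠ 0 → 0 < (B v v).re)
    (hBinv : ∀ (g : G) (v w : V), B (ρ g v) (ρ g w) = B v w)
    {W : Type*} [AddCommGroup W] [Module ℂ W] {σ : Representation ℂ G W} (hσ : σ.IsSmooth)
    (h0 : ∀ T : σ.IntertwiningMap ρ, T = 0) (ν : Measure G) [ν.IsHaarMeasure]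
    [ν.IsInvInvariant] (hL2 : ∀ w v : V, MemLp (fun x => B w (ρ x v)) 2 ν)
    (φ : Module.Dual ℂ W) (hφ : ∀ w' : W, MemLp (fun x => φ (σ x w')) 2 ν) (w : W) (a b : V) :
    ∫ x, conj (B b (ρ x a)) * φ (σ x w) ∂ν = 0 := by
  have hBdef := Representation.eq_zero_of_sesqForm_self_eq_zero hBpos
  -- integrability of `x ↦ conj (B (ρ x b) a) * φ (σ x⁻¹ w)` (Hölder `2 + 2`)
  have hint : ∀ (a : V) (w : W),
      Integrable (fun x => conj (B (ρ x b) a) * φ (σ x⁻¹ w)) ν := fun a w => by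
    have h1 : (fun x => conj (B (ρ x b) a) * φ (σ x⁻¹ w)) = (fun x => B a (ρ x b)) * ((fun x => φ (σ x w)) ∘ Inv.inv) := by
      funext x
      simp only [Pi.mul_apply, Function.comp_apply]
      rw [hBsymm.eq (ρ x b) a]
    rw [h1]
    have hinvL2 : MemLp ((fun x => φ (σ x w)) ∘ (Inv.inv : G → G)) 2 ν := by
      have h : MemLp (fun x => φ (σ x w)) 2 (Measure.map (Inv.inv : G → G) ν) := by
        rw [Measure.map_inv_eq_self]; exact hφ w
      exact h.comp_of_map continuous_inv.measurable.aemeasurable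
    exact (hL2 a b).integrable_mul hinvL2
  -- the pairing `P a w := ∫ conj (B (ρ x b) a) * φ (σ x⁻¹ w) dν` and its invariance
  set P : V → W → ℂ := fun a w => ∫ x, conj (B (ρ x b) a) * φ (σ x⁻¹ w) ∂ν with hP
  have hPinv : ∀ (g : G) (a : V) (w : W), P (ρ g a) (σ g w) = P a w := by
    intro g a w
    simp only [hP]
    have key : ∀ x, conj (B (ρ x b) (ρ g a)) * φ (σ x⁻¹ (σ g w)) =
        (fun y => conj (B (ρ y b) a) * φ (σ y⁻¹ w)) (g⁻¹ * x) := by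
      intro x
      simp only [mul_inv_rev, inv_inv, map_mul, Module.End.mul_apply]
      rw [← hBinv g⁻¹ (ρ x b) (ρ g a), Representation.inv_self_apply]
    simp_rw [key]
    exact integral_mul_left_eq_self (μ := ν) (fun y => conj (B (ρ y b) a) * φ (σ y⁻¹ w)) g⁻¹
  have hPadd : ∀ (a₁ a₂ : V) (w : W), P (a₁ + a₂) w = P a₁ w + P a₂ w := by
    intro a₁ a₂ w
    simp only [hP, map_add, add_mul]
    exact integral_add (hint a₁ w) (hint a₂ w)
  have hPsmul : ∀ (z : ℂ) (a : V) (w : W), P (z • a) w = conj z * P a w := by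
    intro z a w
    simp only [hP, map_smul, smul_eq_mul, map_mul, mul_assoc]
    exact integral_const_mul _ _
  have hPaddr : ∀ (a : V) (w₁ w₂ : W), P a (w₁ + w₂) = P a w₁ + P a w₂ := by
    intro a w₁ w₂
    simp only [hP, map_add, mul_add]
    exact integral_add (hint a w₁) (hint a w₂)
  have hPsmulr : ∀ (z : ℂ) (a : V) (w : W), P a (z • w) = z * P a w := by
    intro z a w
    simp only [hP, map_smul, smul_eq_mul, mul_left_comm _ z]
    exact integral_const_mul _ _
  -- for each `w`, `a ↦ conj (P a w)` is a smooth linear form on `V`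
  let ℓ : W → Module.Dual ℂ V := fun w =>
    { toFun := fun a => conj (P a w)
      map_add' := fun a₁ a₂ => by
        simp only [hPadd, map_add]
      map_smul' := fun z a => by
        simp only [hPsmul, map_mul, Complex.conj_conj, RingHom.id_apply, smul_eq_mul] }
  have hℓapply : ∀ (w : W) (a : V), ℓ w a = conj (P a w) := fun w a => rfl
  have hℓ : ∀ w, ℓ w ∈ ρ.contragredient := by
    intro w
    rw [Representation.mem_contragredient]
    refine ρ.dual.isSmoothVector_of_le (hσ w) fun g hg => ?_
    rw [Representation.mem_stabilizerSubgroup] at hg ⊢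
    refine LinearMap.ext fun a => ?_
    simp only [Representation.dual_apply, Module.Dual.transpose_apply, LinearMap.comp_apply, hℓapply]
    rw [← hPinv g (ρ g⁻¹ a) w, Representation.self_inv_apply, hg]
  -- Riesz: `ℓ w = B (A w)`; `A` is additive, homogeneous and `G`-equivariant
  have hex : ∀ w, ∃ u : V, B u = ℓ w := fun w =>
    Representation.exists_sesqForm_apply_eq_of_mem_contragredient hadm hBinv hBdef (hℓ w)
  choose A hA using hex
  have hBA : ∀ (a : V) (w : W), B (A w) a = conj (P a w) := fun a w => by
    rw [hA, hℓapply]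
  have hAadd : ∀ w₁ w₂, A (w₁ + w₂) = A w₁ + A w₂ := fun w₁ w₂ =>
    Representation.eq_of_sesqForm_apply_eq hBdef (LinearMap.ext fun a => by
      rw [map_add, LinearMap.add_apply, hBA, hBA, hBA, hPaddr, map_add])
  have hAsmul : ∀ (z : ℂ) (w : W), A (z • w) = z • A w := fun z w =>
    Representation.eq_of_sesqForm_apply_eq hBdef (LinearMap.ext fun a => by
      simp only [LinearMap.map_smulₛₗ, LinearMap.smul_apply, hBA, hPsmulr, map_mul, smul_eq_mul])
  have hAG : ∀ (g : G) (w : W), A (σ g w) = ρ g (A w) := fun g w =>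
    Representation.eq_of_sesqForm_apply_eq hBdef (LinearMap.ext fun a => by
      rw [hBA, ← hBinv g⁻¹ (ρ g (A w)) a, Representation.inv_self_apply, hBA, ← hPinv g⁻¹ a (σ g w),
        Representation.inv_self_apply])
  -- `A` is an intertwiner `σ → ρ`, hence zero
  let A' : σ.IntertwiningMap ρ :=
    ⟨{ toFun := A, map_add' := hAadd, map_smul' := hAsmul }, fun g => by
      refine LinearMap.ext fun w' => ?_
      exact hAG g w'⟩
  have hA0 : ∀ w', A w' = 0 := fun w' => by
    have hA' : A'.toLinearMap = 0 := by rw [h0 A', Representation.IntertwiningMap.zero_toLinearMap]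
    exact LinearMap.congr_fun hA' w'
  have hP0 : P a w = 0 := by
    have h := hBA a w
    rw [hA0, map_zero, LinearMap.zero_apply] at h
    rw [← Complex.conj_conj (P a w), ← h, map_zero]
  -- transport along `x ↦ x⁻¹`
  calc ∫ x, conj (B b (ρ x a)) * φ (σ x w) ∂ν
      = ∫ x, (fun y => conj (B (ρ y b) a) * φ (σ y⁻¹ w)) x⁻¹ ∂ν := by
        refine integral_congr_ae (Filter.Eventually.of_forall fun x => ?_)
        simp only [inv_inv]
        rw [← hBinv x (ρ x⁻¹ b) a, Representation.self_inv_apply]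
    _ = P a w := by
        rw [hP]
        exact integral_inv_eq_self (fun y => conj (B (ρ y b) a) * φ (σ y⁻¹ w)) ν
    _ = 0 := hP0

/-- **Theorem 1 (b) for non-isomorphic irreducibles (`L²` coefficients)**: if `σ` is smooth irreducible and not isomorphic to `ρ` (`IsEmpty (σ.Equiv ρ)`),
every intertwiner `σ → ρ` vanishes (Schur), so `∫ conj (B b (ρ x a)) · φ (σ x w) dν = 0` for every smooth functional `φ` with `L²` coefficients.
[cite: HarishChandra1970, Part I §1 Theorem 1 (b)] [cite: Rogawski1990, §12.6 Prop. 12.6.1 p. 188] -/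
theorem integral_conj_matrixCoeff_mul_matrixCoeff_eq_zero_of_isEmpty_of_memLp
    [ρ.IsIrreducible] (hadm : ρ.IsAdmissible) (hBsymm : B.IsSymm)
    (hBpos : ∀ v : V, v ≠ 0 → 0 < (B v v).re)
    (hBinv : ∀ (g : G) (v w : V), B (ρ g v) (ρ g w) = B v w)
    {W : Type*} [AddCommGroup W] [Module ℂ W] {σ : Representation ℂ G W} [σ.IsIrreducible]
    (hσ : σ.IsSmooth) (hne : IsEmpty (σ.Equiv ρ)) (ν : Measure G) [ν.IsHaarMeasure]
    [ν.IsInvInvariant] (hL2 : ∀ w v : V, MemLp (fun x => B w (ρ x v)) 2 ν)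
    (φ : Module.Dual ℂ W) (hφ : ∀ w' : W, MemLp (fun x => φ (σ x w')) 2 ν) (w : W) (a b : V) :
    ∫ x, conj (B b (ρ x a)) * φ (σ x w) ∂ν = 0 :=
  haveI := hne
  integral_conj_matrixCoeff_mul_matrixCoeff_eq_zero_of_memLp hadm hBsymm hBpos hBinv hσ
    (fun T => Subsingleton.elim T 0) ν hL2 φ hφ w a b

end Generic

end Summit.HodgeConjecture.HodgeConjecture.Cruxes.H413.K2E3SchurOrthogonalityBSquareIntegrable

end
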